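import Summits.BirchSwinnertonDyer.BirchSwinnertonDyer.Theorems.ManinLocalTwoThreeBalancedCuspDiffsModFour
import Summits.BirchSwinnertonDyer.BirchSwinnertonDyer.Theorems.ManinLocalTwoThreeDegeneracyUnitTwist
import Summits.BirchSwinnertonDyer.Rank1Residual.ManinAdditive.KatoCurveKPWitness
import HarnessLib

/-!
# E-es-87♭⁺ PROVED at EVERY level `3 ∣ N`: the tame even unit twist of ODD order (`OddTameUnitTwistOfPlusIndexPrimeToThree` BY
# NAME), from THEOREM B″ (prime conductors `ℓ ≡ −1 (mod 4N)`); the KP witness for `ā ≠ +1` at every squarefull level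

Summit `BirchSwinnertonDyer`, route `ManinLocalTwoThree` (cell bsd-f2-manin), crux C3 `ManinPrimeToThreeAtNine`
(stmt-BirchSwinnertonDyer-22968).  Sequel of `…TameUnitTwist` (E-es-87♭, and 87♭⁺ at `4 ∣ N`) and `…BalancedCuspDiffsModFour`
(THEOREM B″).  es's law **E-es-87♭⁺** `OddTameUnitTwistOfPlusIndexPrimeToThree` (leaf `…ManinAdditive.KatoCurveKPWitness`,
typer p664596; «for odd `N` it needs the variant B″ of THEOREM B′ over the prime class `m ≡ −1 (mod 4N)`») is proved here for
every `N`: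

* `modularSymbol_intCast_div_eq_val` — `{∞, b/m}_f = {∞, (b mod m)/m}_f` for `b ∈ ℤ` (public form).
* `exists_odd_tameUnitTwist_of_plusIndexPrimeToThree` — rational newform `f` on `Γ₀(N)`, `3 ∣ N`, plus index prime to `3` ⟹ a
  prime `m ≡ −1 (mod 4N)`, `m > 3N`, an even primitive `χ ≠ 1` mod `m` of ODD order prime to `3`, `S_χ = r·Ω⁺_f`, `s·r/3` never an
  algebraic integer (`3 ∤ s`).  Proof = the E-es-87♭ proof with B″ in place of B′: `m ≡ 3 (mod 4)` makes `ord χ ∣ (m − 1)/2` odd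
  (`DirichletCharacter.orderOf_dvd_div_two_of_even`, Euler's criterion).
* `oddTameUnitTwistOfPlusIndexPrimeToThree_holds : OddTameUnitTwistOfPlusIndexPrimeToThree` — **E-es-87♭⁺ BY NAME**.
* `threeAdicKPWitness_of_plusIndexPrimeTo_of_kp_ne_one` — the KP witness for `ā(W) ≠ +1` (Kosters–Pannekoek «never» or
  «`ℚ₉` only») at EVERY squarefull level `9 ∣ N`, `W` additive at `3` (hadd-form, route-cone-free): odd order ⟹ `χ(3) ≠ −1`
  (`mul_kpSignThree_ne_one_of_odd`); this removes the `4 ∣ N` restriction of `…KPWitnessSquarefull`'s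
  `threeAdicKPWitness_of_plusIndexPrimeTo_of_four_dvd_of_kp_ne_one` (the law E-es-87± BY NAME under `hnf` is in the cone sequel).

HONEST FRAMING: f-level theorems about period lattices of rational newforms + one W-level witness; C3, Manin's conjecture and BSD
are NOT proved by this.  No definitions, no named facts, no sorry.
-/

set_option linter.dupNamespace false
set_option autoImplicit false

noncomputable section

open scoped Classical MatrixGroups ModularForm ComplexConjugate

open CongruenceSubgroup Complex Literature.NumberTheory.EllipticCurves
  Literature.NumberTheory.EllipticCurves.ModularForms
  Summit.BirchSwinnertonDyer.Rank1Residual.ManinAdditive.Gamma1Lattice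
  Summit.BirchSwinnertonDyer.Rank1Residual.ManinAdditive.KatoCurve

namespace Summit.BirchSwinnertonDyer.BirchSwinnertonDyer.Theorems.ManinLocalTwoThree

variable {N : ℕ} [NeZero N]

/-! ### §1 An integer-numerator cusp is a residue cusp -/

/-- `{∞, b/m}_f = {∞, (b mod m)/m}_f` for `b ∈ ℤ` (translation invariance; public form of the `…TameUnitTwist` lemma). -/
theorem modularSymbol_intCast_div_eq_val (f : CuspForm (Gamma0 N) 2) {m : ℕ} [Fact m.Prime] (b : ℤ) :
    modularSymbol f ((b : ℚ) / ((m : ℤ) : ℚ)) = modularSymbol f ((((b : ZMod m)).val : ℚ) / m) := by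
  have hmQ : (m : ℚ) ≠ 0 := by exact_mod_cast (Fact.out : m.Prime).ne_zero
  have hv : (((b : ZMod m)).val : ℤ) = b % m := ZMod.val_intCast b
  have hb : (b : ℚ) / ((m : ℤ) : ℚ) = ((((b : ZMod m)).val : ℚ) / m) + ((b / m : ℤ) : ℚ) := by
    have e1 : (b : ℚ) = ((b % m : ℤ) : ℚ) + (m : ℚ) * ((b / m : ℤ) : ℚ) := by
      exact_mod_cast (Int.emod_add_mul_ediv b m).symm
    have e2 : ((((b : ZMod m)).val : ℚ)) = ((b % m : ℤ) : ℚ) := by exact_mod_cast hv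
    rw [e2, e1]
    push_cast
    field_simp
  rw [hb, modularSymbol_add_intCast_holds f]

/-! ### §2 E-es-87♭⁺ at every level: the odd-order unit twist from THEOREM B″ -/

/-- **E-es-87♭⁺, every `N`.**  For a rational newform `f` on `Γ₀(N)`, `3 ∣ N`, with plus index `[Λ_f⁺ : Λ₁(f)⁺]` prime to `3`:
a prime `m > 3N`, `m ≡ −1 (mod 4N)`, an even primitive Dirichlet character `χ ≠ 1` mod `m` of ODD order prime to `3`, and `r`
with `S_χ = r·Ω⁺_f` and `s·r/3` not an algebraic integer for every `3 ∤ s`.  (THEOREM B″ + closure induction + the span lemma,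
as for E-es-87♭; `m ≡ 3 (mod 4)` gives the odd order.) -/
theorem exists_odd_tameUnitTwist_of_plusIndexPrimeToThree (f : CuspForm (Gamma0 N) 2) (hf : IsNewform0 f)
    (hQ : coeffField f = ⊥) (h3 : 3 ∣ N) (hd : PlusIndexPrimeTo 3 f) :
    ∃ (m : ℕ) (_ : NeZero m) (χ : DirichletCharacter ℂ m) (r : ℂ),
      m.Coprime (3 * N) ∧ χ.IsPrimitive ∧ χ ≠ 1 ∧ Odd (orderOf χ) ∧ ¬ 3 ∣ orderOf χ ∧ χ.Even ∧
      twistedSymbolSum f χ = r * (plusPeriod f : ℂ) ∧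
      ∀ s : ℕ, ¬ 3 ∣ s → ¬ IsIntegral ℤ ((s : ℂ) * r / 3) := by
  haveI : NeZero (4 * N) := ⟨mul_ne_zero (by norm_num) (NeZero.ne N)⟩
  obtain ⟨hpos, -⟩ := plusPeriod_pos_and_realPeriods_eq isZLattice_periodLattice_holds hf hQ
  have hΩ : (plusPeriod f : ℂ) ≠ 0 := by exact_mod_cast hpos.ne'
  have hreal : ∀ n, (cuspCoeff f n).im = 0 := cuspCoeff_im_eq_zero_of_coeffField_eq_bot hQ
  -- THEOREM B″ + closure induction: a generator with plus part not in `3ℤΩ⁺`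
  set S : Set ℂ := {z : ℂ | ∃ (ℓ : ℕ) (b b' : ℤ), ℓ.Prime ∧ 3 * N < ℓ ∧ ((ℓ : ℤ) : ZMod (4 * N)) = -1 ∧
      IsCoprime b ℓ ∧ IsCoprime b' ℓ ∧
      z = modularSymbol f ((b : ℚ) / (ℓ : ℤ)) - modularSymbol f ((b' : ℚ) / (ℓ : ℤ))} with hS
  have hSΛ : S ⊆ periodLattice f := by
    rintro z ⟨ℓ, b, b', hℓ, -, hℓ4, hb, hb', rfl⟩
    exact periodLatticeGamma1_le_periodLattice f (balancedCuspDiff_modFour_mem_periodLatticeGamma1 f hℓ hℓ4 hb hb')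
  have hd' : ∀ x ∈ periodLattice f, ∃ y ∈ AddSubgroup.closure S, ∃ k : ℕ, ¬ 3 ∣ k ∧
      (k : ℂ) * (x + conj x) = y + conj y := by
    intro x hx
    obtain ⟨y, hy, k, hk, hxy⟩ := hd x hx
    exact ⟨y, periodLatticeGamma1_le_closure_balancedCuspDiffs_modFour f (3 * N) hy, k, hk, hxy⟩
  obtain ⟨z, ⟨m, b, b', hmp, hmn, hm4, hb, hb', rfl⟩, j, hj, hj3⟩ := exists_mem_plus_not_three_dvd hf hQ hSΛ hd'
  haveI : Fact m.Prime := ⟨hmp⟩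
  -- arithmetic of `m`: `4N ∣ m + 1`
  have h4N : 4 * N ∣ m + 1 := by
    have h0 : (((m + 1 : ℕ) : ℤ) : ZMod (4 * N)) = 0 := by
      push_cast
      rw [show ((m : ℕ) : ZMod (4 * N)) = ((m : ℤ) : ZMod (4 * N)) by push_cast; rfl, hm4, neg_add_cancel]
    exact Int.natCast_dvd_natCast.mp ((ZMod.intCast_zmod_eq_zero_iff_dvd _ (4 * N)).mp h0)
  have hmN1 : N ∣ m + 1 := dvd_trans (Dvd.intro_left 4 rfl) h4N
  have hmN : ¬ m ∣ N := fun h ↦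
    absurd (Nat.le_of_dvd (NeZero.pos N) h) (not_le.mpr (lt_of_le_of_lt (Nat.le_mul_of_pos_left N (by norm_num)) hmn))
  have hNm : IsCoprime (N : ℤ) m :=
    (Nat.isCoprime_iff_coprime.mpr ((Nat.Prime.coprime_iff_not_dvd hmp).mpr hmN)).symm
  have hm3 : ¬ 3 ∣ m.totient := by
    rw [Nat.totient_prime hmp]
    have h3m : 3 ∣ m + 1 := dvd_trans h3 hmN1
    have h1m := hmp.one_le
    intro h
    omega
  have hodd : Odd (m / 2) := by
    have h4m : 4 ∣ m + 1 := dvd_trans (Dvd.intro N rfl) h4N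
    rw [Nat.odd_iff]
    omega
  -- the integer-valued even function `F`
  have hF : ∀ a : ZMod m, ∃ k : ℤ, (modularSymbol f ((a.val : ℚ) / m) - modularSymbol f 0) +
      conj (modularSymbol f ((a.val : ℚ) / m) - modularSymbol f 0) = (k : ℂ) * (plusPeriod f : ℂ) :=
    fun a ↦ exists_int_add_conj_eq_mul_plusPeriod hf hQ (cuspDiff_mem_periodLattice f hNm a)
  choose F hF using hF
  have hFeven : ∀ a : ZMod m, F (-a) = F a := by
    intro a
    have h1 := hF (-a)
    rw [cuspDiff_neg_val_eq_conj f hreal, Complex.conj_conj, add_comm, hF a] at h1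
    exact_mod_cast (mul_right_cancel₀ hΩ h1).symm
  -- `F b − F b' = j`, not divisible by `3`
  have hzF : (j : ℂ) * (plusPeriod f : ℂ) =
      ((F (b : ZMod m) - F (b' : ZMod m) : ℤ) : ℂ) * (plusPeriod f : ℂ) := by
    rw [← hj, modularSymbol_intCast_div_eq_val f b, modularSymbol_intCast_div_eq_val f b']
    have e : modularSymbol f ((((b : ZMod m)).val : ℚ) / m) - modularSymbol f ((((b' : ZMod m)).val : ℚ) / m) =
        (modularSymbol f ((((b : ZMod m)).val : ℚ) / m) - modularSymbol f 0) -
          (modularSymbol f ((((b' : ZMod m)).val : ℚ) / m) - modularSymbol f 0) := by ring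
    rw [e, map_sub, Int.cast_sub, sub_mul, ← hF, ← hF]
    ring
  have hjF : j = F (b : ZMod m) - F (b' : ZMod m) := by
    have := mul_right_cancel₀ hΩ hzF
    exact_mod_cast this
  have hunit : IsUnit ((b : ℤ) : ZMod m) := (ZMod.coe_int_isUnit_iff_isCoprime b m).mpr hb.symm
  have hunit' : IsUnit ((b' : ℤ) : ZMod m) := (ZMod.coe_int_isUnit_iff_isCoprime b' m).mpr hb'.symm
  -- the span lemma, contrapositively
  have hex : ∃ χ : DirichletCharacter ℂ m, χ ≠ 1 ∧
      ∀ s : ℕ, ¬ 3 ∣ s → ¬ IsIntegral ℤ ((s : ℂ) * (∑ a : ZMod m, χ a * (F a : ℂ)) / (3 : ℕ)) := by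
    by_contra hcon
    push Not at hcon
    have := Int.dvd_sub_of_forall_isIntegral_charSum_div Nat.prime_three hm3 F
      (fun χ hχ ↦ hcon χ hχ) hunit hunit'
    exact hj3 (hjF ▸ (by exact_mod_cast this))
  obtain ⟨χ, hχ1, hχ⟩ := hex
  -- `χ` is even
  have hev : χ.Even := by
    rcases χ.even_or_odd with h | h
    · exact h
    · exfalso
      have hzero : ∑ a : ZMod m, χ a * (F a : ℂ) = 0 := by
        have hneg : ∑ a : ZMod m, χ a * (F a : ℂ) = -∑ a : ZMod m, χ a * (F a : ℂ) := by
          rw [← Finset.sum_neg_distrib]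
          refine Fintype.sum_equiv (Equiv.neg (ZMod m)) _ _ fun a ↦ ?_
          rw [Equiv.neg_apply, h.eval_neg, hFeven]; ring
        have := add_eq_zero_iff_eq_neg.mpr hneg
        rw [← two_mul] at this
        exact (mul_eq_zero.mp this).resolve_left two_ne_zero
      refine hχ 1 (by norm_num) ?_
      rw [hzero, mul_zero, zero_div]
      exact isIntegral_zero
  -- package
  have hcop : m.Coprime (3 * N) :=
    (Nat.Prime.coprime_iff_not_dvd hmp).mpr fun h ↦
      absurd (Nat.le_of_dvd (Nat.mul_pos (by norm_num) (NeZero.pos N)) h) (not_le.mpr hmn)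
  refine ⟨m, inferInstance, χ, (∑ a : ZMod m, χ a * (F a : ℂ)) / 2, hcop, DirichletCharacter.isPrimitive_of_prime hχ1, hχ1,
    hodd.of_dvd_nat (DirichletCharacter.orderOf_dvd_div_two_of_even hev),
    fun h ↦ hm3 (dvd_trans h (DirichletCharacter.orderOf_dvd_totient χ)), hev, ?_, ?_⟩
  · have h2 := two_mul_twistedSymbolSum_eq_sum_plus f hreal hχ1 hev
    simp_rw [hF, ← mul_assoc, ← Finset.sum_mul] at h2
    have : twistedSymbolSum f χ = (∑ a : ZMod m, χ a * (F a : ℂ)) * (plusPeriod f : ℂ) / 2 := by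
      rw [← h2]; ring
    rw [this]; ring
  · intro s hs hI
    refine hχ s hs ?_
    have e : ((s : ℂ) * (∑ a : ZMod m, χ a * (F a : ℂ)) / (3 : ℕ)) =
        ((2 : ℤ) : ℂ) * ((s : ℂ) * ((∑ a : ZMod m, χ a * (F a : ℂ)) / 2) / 3) := by push_cast; ring
    rw [e]
    exact IsIntegral.mul (by simpa using isIntegral_algebraMap (R := ℤ) (A := ℂ) (x := (2 : ℤ))) hI

/-- **E-es-87♭⁺ `OddTameUnitTwistOfPlusIndexPrimeToThree` holds** (the leaf's law closed BY NAME, every level `3 ∣ N`). -/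
theorem oddTameUnitTwistOfPlusIndexPrimeToThree_holds : OddTameUnitTwistOfPlusIndexPrimeToThree :=
  fun f hf hQ h3 hd ↦ exists_odd_tameUnitTwist_of_plusIndexPrimeToThree f hf hQ h3 hd

/-! ### §3 The KP witness for `ā ≠ +1` at every squarefull level -/

/-- **KP witness for `ā(W) ≠ +1` at every squarefull level `9 ∣ N`** (`W` additive at `3`, plus index prime to `3`): the odd-order
unit twist of E-es-87♭⁺ never takes the value `−1`, so the Kosters–Pannekoek clause `χ(3)·ā ≠ 1` holds for `ā ∈ {0, −1}`. -/
theorem threeAdicKPWitness_of_plusIndexPrimeTo_of_kp_ne_one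
    (W : WeierstrassCurve ℚ) [W.IsElliptic] {N : ℕ} [NeZero N] (D : ModularParametrizationData W N)
    (hadd : ¬ W.HasGoodReductionAtPrime 3 ∧ ¬ W.HasMultiplicativeReductionAtPrime 3)
    (h9 : 3 ^ 2 ∣ N) (hsq : IsSquarefull N) (h1 : kpSignThree W ≠ 1) (hpi : PlusIndexPrimeTo 3 D.f) :
    ThreeAdicKPWitness W W D.f := by
  have h3 : 3 ∣ N := dvd_trans (by norm_num) h9
  obtain ⟨m, hm, χ, r, hcop, hprim, hne, hodd, hord, hev, hr, hu⟩ :=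
    exists_odd_tameUnitTwist_of_plusIndexPrimeToThree D.f D.isNewformOf.1 D.isNewformOf.coeffField_eq_bot h3 hpi
  have hempty : (N.primeFactors.filter fun ℓ ↦ ¬ ℓ ^ 2 ∣ N) = ∅ :=
    Finset.filter_eq_empty_iff.mpr fun ℓ hℓ h ↦ h (hsq ℓ hℓ)
  refine ⟨m, hm, χ, r, 1, D.isNewformOf, hadd.1, hadd.2, hcop, hprim, hne, hord,
    mul_kpSignThree_ne_one_of_odd χ W hodd h1, hev, by simp, ?_, ?_⟩
  · rw [hempty, Finset.prod_empty, one_mul, hr]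
  · intro s hs
    have : (s : ℂ) * r * ((1 : ℚ) : ℂ) / 3 = (s : ℂ) * r / 3 := by push_cast; ring
    rw [this]
    exact hu s hs

end Summit.BirchSwinnertonDyer.BirchSwinnertonDyer.Theorems.ManinLocalTwoThree

end
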